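import Summits.QuantumFields.BalabanUV.T4Continuum.Support.ColourMultiplierRows
import Summits.QuantumFields.BalabanUV.T4Continuum.Support.RegularBackgroundTower

/-!
# T⁴ programme, NE2 (U1a) sub-row Δ3 (`T4-U1a.S-NE2-D3-WALK°`) — `hdec` AND THE DECAY STATIONS FOR TIER A's NON-ABELIAN
# COVARIANT-LAPLACIAN MODEL `Δ^{R_k} − Δ^1 ⊗ 1` AT SMALL COUPLING ON A CUBIC UNIT TORUS (`a = 1`): no displayed `hdec`

NE2 formalisation swarm `b2b-balaban-t4-ne2-formalise-*`, leaf prover 05 (gen 6); file 2∕2 of the supplier item «NE2-Δ3-COVLAP-HDEC» (INTENT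
CLAIMS.log 2026-08-20T15:36Z), the natural consumer of this seat's «Δ3-GRAD-TRANSPORT» (files `GradientRowSumTransport` p223049,
`SmallCouplingEntryDecayGrad` p223232, `SmallCouplingEntryDecaySandwich` p223413).  Tier A (t4-ne2-p1 gen 9, `Support/ColourCovariantLaplacian`)
proved the EXACT decomposition `covLapC_sub_lapC_eq`: `Δ^R − Δ^1⊗1 = F + Fᴴ + siteMul z`, `F = Σ_ν siteMul(−w_ν)·(∇_ν ⊗ 1)`, and the
operator-norm `PerturbationLaws` for the tower family `covPertC L M R`.  THIS FILE reads the same decomposition in sub-row Δ3's weighted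
row-sum currency:
 * (file 1∕2 `Support/ColourMultiplierRows` supplies the bookkeeping: a unit translation moves a block by `≤ 1`; weighted rows of `siteMul v`
   and of `(S_ν⊗1)ᴴ·siteMul v`; `(S_ν⊗1)·siteMul v·(S_ν⊗1)ᴴ = siteMul (v ∘ τ_ν)`; `(∇_ν⊗1)ᴴ = −(S_ν⊗1)ᴴ·(∇_ν⊗1)`;)
 * §3 **`covPertC_eq_leftClass`**: `covPertC L M R k = Σ_ν C′_ν k·(∇_ν⊗1) + C₀′ k` with
   `C′_ν = siteMul(−w_ν) − (S_ν⊗1)ᴴ·siteMul((−w_ν)ᴴ ∘ τ_ν)` and `C₀′ = Σ_ν −n_k•(S_ν⊗1)ᴴ·(siteMul((−w_ν)ᴴ∘τ_ν) − siteMul((−w_ν)ᴴ)) + siteMul z`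
   (file 3's `fdiff_kron_mul_eq` on `Fᴴ`), and the row bounds of `C′_ν`, `C₀′` from tier A's ENTRYWISE `LipschitzBackground` (`bound`,
   `lipschitz`) of `−w` and `BoundedBackground.bound` of `z`: `κ₁ = (card o)·α·(1 + e^{δ′})`, `κ₀ = (d+1)·e^{δ′}·(card o)·β + (card o)·α′`;
 * §4 **`hdec_pertCovC_covPertC`** (`SmallCouplingEntryDecayGrad.hdec_pertCovC_firstOrder` BY NAME) from RAW entrywise data (size of `−w`,
   `β/n_k`-Lipschitz entries, size of `z` — no two-level consistency, no NE3): on a cubic unit torus `M ≡ N₀`, for `δ′ < min(δ_∇, δ₁, δ₂)` and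
   `‖t‖·κ_w < 1`, `κ_w = (d+1)κ₁·B_∇K_{d+1}(δ_∇ − δ′) + κ₀·W_G(δ′)`: `∀ k, EntryDecay dist₀ (pertCovC L M 1 _ (covPertC L M R) t k) (W_G/(1 − ‖t‖κ_w)) δ′`;
   in tier A's letters `hdec_pertCovC_colourCovariantLaplacian` (`LipschitzBackground`∕`BoundedBackground`), in tier B's letters
   **`hdec_pertCovC_covPertC_of_regular`** (`RegularTransporters L M R α β` ALONE — the `covPertC` summand of `balabanPert = covPertC + avgPert + P₄`);
   **`decayStations_colourCovariantLaplacian`** = the row owner's `NE2BalabanDecayRate.decayStations_pertCovC` BY NAME with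
   `hpert := perturbationLaws_colourCovariantLaplacian` (a = 1) and this `hdec`: TIER A's colour model in King's (4.38) decay shape — limit
   entry decay, `DecayRate`, `TwoLevelDecayRate` — with displayed binders = the background DATA bounds, `2 ≤ L`, `1 ≤ d+1`, the cubic torus,
   the two coupling discs, nothing else; **`…_cubic`**: the packaged `∃ B_∇ δ_∇ > 0` form.

HONEST FRAMING (T4-DAG p. 1).  Tier A = MODEL level (transporters are DATA, global small field, `−∂P∂*`∕`aQ*Q` not covariantized); `a = 1`;
CUBIC unit tori `M ≡ N₀`; small coupling = an explicit disc (not `‖t‖ ≤ 1`); constants crude (NE3's existential `B_∇, δ_∇`, pv15's `W_G`,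
`card o` factors); of tier B's `balabanPert` ONLY the `covPertC` summand (not `avgPert`, not the gauge slot `P₄`); nothing printed asserted ([B5] (1.110) p.35, [B9] (3.3) p.390 are TEXT LOCATIONS); sub-row Δ3 NOT
closed for Bałaban's carrier; **NE2 (U1a) NOT PROVED**; spine PROVED 0/9; NOT infinite volume, NOT a mass gap, NOT Clay.  HONEST DEPENDENCY:
continuum YM on T⁴ ⇐ BetaPertH ∧ nine spine estimates (0/9 proved); BetaPertH ⇐ (D1) ∧ (D4) ∧ CAP+tail; G-an2-4 gates asym, D1 and NE2/3/4.
ABSOLUTE RULE kept; no `def`; no `sorry`.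
-/


noncomputable section

open scoped BigOperators ComplexConjugate Matrix Kronecker
open Finset

namespace Summit.QuantumFields.BalabanUV.T4Continuum.SmallCouplingEntryDecayCovariant

open Literature.MathematicalPhysics.QuantumFieldTheory.Balaban1983to89.B5Prop11Plancherel (Tor fine shiftM fdiff unitVec Cst)
open Literature.MathematicalPhysics.QuantumFieldTheory.Balaban1983to89.B5G183RateUnitTower (lev)
open Literature.MathematicalPhysics.QuantumFieldTheory.Balaban1983to89.B4TorusKernel (periodConst)
open Literature.MathematicalPhysics.QuantumFieldTheory.Balaban1983to89.B4TorusKernel.MultiPeriod (torusSupNorm circAbs circAbs_le_abs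
  circAbs_add_mul)
open Literature.MathematicalPhysics.QuantumFieldTheory.Balaban1983to89.B4Sect5Torus (circAbs_zero circAbs_neg)
open Literature.MathematicalPhysics.QuantumFieldTheory.Balaban1983to89.B4Sect5Proof (latticeConst)
open Literature.MathematicalPhysics.QuantumFieldTheory.Balaban1983to89.B5Blocks16 (blockOf bpt_val)
open Literature.MathematicalPhysics.QuantumFieldTheory.Balaban1983to89.B5G115SupBound (exists_eq_bpt_blockOf)
open Literature.MathematicalPhysics.QuantumFieldTheory.Balaban1983to89.B5DeltaA169 (DeltaA)
open Literature.MathematicalPhysics.QuantumFieldTheory.Balaban1983to89.B5G183Strip (kappa183)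
open Literature.MathematicalPhysics.QuantumFieldTheory.Balaban1983to89.B5G183CovDecay (MD183)
open Literature.MathematicalPhysics.QuantumFieldTheory.Balaban1983to89.B6LowerBound2153Torus (rep)
open Literature.MathematicalPhysics.QuantumFieldTheory.Balaban1983to89.B6Cov2156Torus (one_le_M)
open Summit.QuantumFields.BalabanUV.T4Continuum
open Summit.QuantumFields.BalabanUV.T4Continuum.BalabanAveragedTowerUnit (idx)
open Summit.QuantumFields.BalabanUV.T4Continuum.BackgroundResolventTower (PerturbationLaws Cpert)
open Summit.QuantumFields.BalabanUV.T4Continuum.KingPairingPlantedLaw (calDalev JpcT CJ)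
open Summit.QuantumFields.BalabanUV.T4Continuum.BlockPairingGeometry (tau)
open Summit.QuantumFields.BalabanUV.T4Continuum.AbelianCovariantLaplacian (tauInv tauInv_tau tau_tauInv star_natCast_complex)
open Summit.QuantumFields.BalabanUV.T4Continuum.BlockMultiplication (siteMul siteMul_apply siteMul_conjTranspose siteMul_sub siteMul_smul
  kron_mul_siteMul_apply)
open Summit.QuantumFields.BalabanUV.T4Continuum.FirstOrderBackgroundModel (LipschitzBackground)
open Summit.QuantumFields.BalabanUV.T4Continuum.PerturbationAlgebra (BoundedBackground)
open Summit.QuantumFields.BalabanUV.T4Continuum.ColourCovariantLaplacian (covPertC covLapC_sub_lapC_eq negConnM zfieldC Vab Zab kappaCol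
  C2col perturbationLaws_colourCovariantLaplacian)
open Summit.QuantumFields.BalabanUV.T4Continuum.NE2ColourPerturbedLayer (pertCovC pertLimC)
open Summit.QuantumFields.BalabanUV.T4Continuum.DecayRateInterpolation (EntryDecay DecayRate TwoLevelDecayRate)
open Summit.QuantumFields.BalabanUV.T4Continuum.NE2BalabanDecayRate (decayStations_pertCovC)
open Summit.QuantumFields.BalabanUV.T4Continuum.WeightedRowSumResolvent (wrow_mul_le wrow_nonneg)
open Summit.QuantumFields.BalabanUV.T4Continuum.SmallCouplingEntryDecay (torusSupNorm_rep_triangle torusSupNorm_rep_nonneg)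
open Summit.QuantumFields.BalabanUV.T4Continuum.SmallCouplingEntryDecayGrad (wrow_add_le wrow_sum_le hdec_pertCovC_firstOrder)
open Summit.QuantumFields.BalabanUV.T4Continuum.SmallCouplingEntryDecaySandwich (fdiff_kron_eq conjTranspose_shiftK_mul fdiff_kron_mul_eq
  shiftK_apply)
open Summit.QuantumFields.BalabanUV.T4Continuum.GradientRowSumTransport (weighted_row_sum_fdiff_inv_le_cubic)
open Summit.QuantumFields.BalabanUV.T4Continuum.ColourMultiplierRows
open Summit.QuantumFields.BalabanUV.T4Continuum.RegularBackgroundTower (RegularTransporters negConnM_eq_neg norm_connTower_le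
  connTower_lipschitz norm_zTower_le)
open Summit.QuantumFields.BalabanUV.T4Continuum.KroneckerUnits (norm_entry_le)

variable {d : ℕ}

/-! ## §3 Tier A's perturbation `Δ^{R_k} − Δ^1⊗1` regrouped into the left first-order class, and its coefficient row bounds -/

section Regroup

variable (L : ℕ) [NeZero L] (M : Fin (d + 1) → ℕ) [hM : ∀ μ, NeZero (M μ)]
variable {o : Type*} [Fintype o] [DecidableEq o]

/-- **THE REGROUPING** of tier A's `covLapC_sub_lapC_eq` (`Δ^R − Δ^1⊗1 = F + Fᴴ + siteMul z`) into the LEFT first-order class of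
`SmallCouplingEntryDecayGrad`: `covPertC L M R k = Σ_ν C′_ν·(∇_ν⊗1) + C₀′` with `C′_ν = siteMul(−w_ν) − (S_ν⊗1)ᴴ·siteMul((−w_ν)ᴴ∘τ_ν)` and
`C₀′ = Σ_ν −(S_ν⊗1)ᴴ·siteMul(n_k•((−w_ν)ᴴ∘τ_ν − (−w_ν)ᴴ)) + siteMul z` (file 3's `∇·B = B^{sh}·∇ + n(B^{sh} − B)` on `Fᴴ`). [folklore] -/
theorem covPertC_eq_leftClass (R : (k : ℕ) → Fin (d + 1) → (idx L M k → Matrix o o ℂ)) (k : ℕ) :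
    covPertC L M R k
      = (∑ ν, (siteMul (negConnM (fine (lev L k) M) ((lev L k : ℕ) : ℂ) (R k) ν)
            - (shiftM (fine (lev L k) M) ν ⊗ₖ (1 : Matrix o o ℂ))ᴴ
              * siteMul (fun i => (negConnM (fine (lev L k) M) ((lev L k : ℕ) : ℂ) (R k) ν (tau (fine (lev L k) M) ν i))ᴴ))
          * (fdiff (fine (lev L k) M) ((lev L k : ℕ) : ℂ) ν ⊗ₖ (1 : Matrix o o ℂ)))
        + ((∑ ν, -((shiftM (fine (lev L k) M) ν ⊗ₖ (1 : Matrix o o ℂ))ᴴ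
              * siteMul (fun i => ((lev L k : ℕ) : ℂ) • ((negConnM (fine (lev L k) M) ((lev L k : ℕ) : ℂ) (R k) ν (tau (fine (lev L k) M) ν i))ᴴ
                  - (negConnM (fine (lev L k) M) ((lev L k : ℕ) : ℂ) (R k) ν i)ᴴ))))
           + siteMul (zfieldC (fine (lev L k) M) ((lev L k : ℕ) : ℂ) (R k))) := by
  have hFH : (∑ ν, siteMul (negConnM (fine (lev L k) M) ((lev L k : ℕ) : ℂ) (R k) ν) * (fdiff (fine (lev L k) M) ((lev L k : ℕ) : ℂ) ν ⊗ₖ (1 : Matrix o o ℂ)))ᴴ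
      = ∑ ν, ((-((shiftM (fine (lev L k) M) ν ⊗ₖ (1 : Matrix o o ℂ))ᴴ * siteMul (fun i => (negConnM (fine (lev L k) M) ((lev L k : ℕ) : ℂ) (R k) ν (tau (fine (lev L k) M) ν i))ᴴ))) * (fdiff (fine (lev L k) M) ((lev L k : ℕ) : ℂ) ν ⊗ₖ (1 : Matrix o o ℂ))
          + -((shiftM (fine (lev L k) M) ν ⊗ₖ (1 : Matrix o o ℂ))ᴴ
              * siteMul (fun i => ((lev L k : ℕ) : ℂ) • ((negConnM (fine (lev L k) M) ((lev L k : ℕ) : ℂ) (R k) ν (tau (fine (lev L k) M) ν i))ᴴ - (negConnM (fine (lev L k) M) ((lev L k : ℕ) : ℂ) (R k) ν i)ᴴ)))) := by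
    rw [Matrix.conjTranspose_sum]
    refine Finset.sum_congr rfl fun ν _ => ?_
    rw [Matrix.conjTranspose_mul, siteMul_conjTranspose, kron_fdiff_conjTranspose, Matrix.neg_mul, Matrix.mul_assoc,
      fdiff_kron_mul_eq L M k ν (siteMul fun i => (negConnM (fine (lev L k) M) ((lev L k : ℕ) : ℂ) (R k) ν i)ᴴ), shiftK_mul_siteMul_mul_conjTranspose, Matrix.mul_add, neg_add,
      ← Matrix.mul_assoc, ← Matrix.neg_mul, ← siteMul_sub, ← siteMul_smul]
  rw [covPertC, covLapC_sub_lapC_eq, hFH, Finset.sum_add_distrib]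
  simp only [Matrix.sub_mul, Finset.sum_sub_distrib, Matrix.neg_mul, Finset.sum_neg_distrib]
  abel

omit [NeZero L] hM [Fintype o] in
/-- entries of the adjoint translates from entries: `‖(−w_ν(τ i))ᴴ a b‖ ≤ α`. [folklore] -/
theorem norm_conjTranspose_tau_le {R : (k : ℕ) → Fin (d + 1) → (idx L M k → Matrix o o ℂ)} (k : ℕ) {α : ℝ}
    (hVb : ∀ ν (i : idx L M k) (a b : o), ‖negConnM (fine (lev L k) M) ((lev L k : ℕ) : ℂ) (R k) ν i a b‖ ≤ α) (ν : Fin (d + 1)) (i : idx L M k) (a b : o) :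
    ‖(negConnM (fine (lev L k) M) ((lev L k : ℕ) : ℂ) (R k) ν (tau (fine (lev L k) M) ν i))ᴴ a b‖ ≤ α := by
  rw [Matrix.conjTranspose_apply, norm_star]
  exact hVb ν _ b a

omit hM [Fintype o] in
/-- the `η`-LIPSCHITZ QUOTIENTS `n_k•((−w_ν(τ i))ᴴ − (−w_ν(i))ᴴ)` are `≤ β` entrywise when the entries are `β/n_k`-Lipschitz. [folklore] -/
theorem norm_lipschitz_quot_le {R : (k : ℕ) → Fin (d + 1) → (idx L M k → Matrix o o ℂ)} (k : ℕ) {β : ℝ}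
    (hVl : ∀ ν (i : idx L M k) (a b : o), ‖negConnM (fine (lev L k) M) ((lev L k : ℕ) : ℂ) (R k) ν (tau (fine (lev L k) M) ν i) a b - negConnM (fine (lev L k) M) ((lev L k : ℕ) : ℂ) (R k) ν i a b‖ ≤ β / (lev L k : ℕ))
    (ν : Fin (d + 1)) (i : idx L M k) (a b : o) :
    ‖(((lev L k : ℕ) : ℂ) • ((negConnM (fine (lev L k) M) ((lev L k : ℕ) : ℂ) (R k) ν (tau (fine (lev L k) M) ν i))ᴴ
        - (negConnM (fine (lev L k) M) ((lev L k : ℕ) : ℂ) (R k) ν i)ᴴ)) a b‖ ≤ β := by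
  have hn : (0 : ℝ) < (lev L k : ℕ) := by exact_mod_cast Nat.pos_of_ne_zero (NeZero.ne (lev L k))
  have h := hVl ν i b a
  rw [Matrix.smul_apply, Matrix.sub_apply, Matrix.conjTranspose_apply, Matrix.conjTranspose_apply, ← star_sub, smul_eq_mul,
    norm_mul, norm_star, Complex.norm_natCast]
  calc ((lev L k : ℕ) : ℝ) * ‖negConnM (fine (lev L k) M) ((lev L k : ℕ) : ℂ) (R k) ν (tau (fine (lev L k) M) ν i) b a
          - negConnM (fine (lev L k) M) ((lev L k : ℕ) : ℂ) (R k) ν i b a‖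
      ≤ ((lev L k : ℕ) : ℝ) * (β / (lev L k : ℕ)) := mul_le_mul_of_nonneg_left h hn.le
    _ = β := by field_simp

/-- **ROW BOUND OF THE FIRST-ORDER COEFFICIENTS** `C′_ν`: `≤ (card o)·α + e^{δ′}·(card o)·α` (`0 ≤ δ′`). [folklore] -/
theorem wrow_Cfirst_le {R : (k : ℕ) → Fin (d + 1) → (idx L M k → Matrix o o ℂ)} (k : ℕ) {α : ℝ}
    (hVb : ∀ ν (i : idx L M k) (a b : o), ‖negConnM (fine (lev L k) M) ((lev L k : ℕ) : ℂ) (R k) ν i a b‖ ≤ α) {δ' : ℝ} (hδ : 0 ≤ δ') (ν : Fin (d + 1)) (i : idx L M k × o) :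
    ∑ j, Real.exp (δ' * torusSupNorm M (rep M (blockOf (lev L k) M i.1.1) - rep M (blockOf (lev L k) M j.1.1)))
        * ‖(siteMul (negConnM (fine (lev L k) M) ((lev L k : ℕ) : ℂ) (R k) ν)
            - (shiftM (fine (lev L k) M) ν ⊗ₖ (1 : Matrix o o ℂ))ᴴ
              * siteMul (fun i => (negConnM (fine (lev L k) M) ((lev L k : ℕ) : ℂ) (R k) ν (tau (fine (lev L k) M) ν i))ᴴ)) i j‖
      ≤ (Fintype.card o : ℝ) * α + Real.exp δ' * ((Fintype.card o : ℝ) * α) :=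
  (wrow_sub_le (fun i j : idx L M k × o => Real.exp (δ' * torusSupNorm M
      (rep M (blockOf (lev L k) M i.1.1) - rep M (blockOf (lev L k) M j.1.1)))) (fun _ _ => (Real.exp_pos _).le) _ _ i).trans
    (add_le_add (wrow_siteMul_le L M k _ (hVb ν) δ' i)
      (wrow_shiftKH_mul_siteMul_le L M k ν _ (norm_conjTranspose_tau_le L M k hVb ν) hδ i))

/-- **ROW BOUND OF THE ZEROTH-ORDER COEFFICIENT** `C₀′`: `≤ (d+1)·e^{δ′}·(card o)·β + (card o)·α′`. [folklore] -/
theorem wrow_Czero_le {R : (k : ℕ) → Fin (d + 1) → (idx L M k → Matrix o o ℂ)} (k : ℕ) {β α' : ℝ}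
    (hVl : ∀ ν (i : idx L M k) (a b : o), ‖negConnM (fine (lev L k) M) ((lev L k : ℕ) : ℂ) (R k) ν (tau (fine (lev L k) M) ν i) a b - negConnM (fine (lev L k) M) ((lev L k : ℕ) : ℂ) (R k) ν i a b‖ ≤ β / (lev L k : ℕ))
    (hzb : ∀ (i : idx L M k) (a b : o), ‖zfieldC (fine (lev L k) M) ((lev L k : ℕ) : ℂ) (R k) i a b‖ ≤ α')
    {δ' : ℝ} (hδ : 0 ≤ δ') (i : idx L M k × o) :
    ∑ j, Real.exp (δ' * torusSupNorm M (rep M (blockOf (lev L k) M i.1.1) - rep M (blockOf (lev L k) M j.1.1)))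
        * ‖((∑ ν, -((shiftM (fine (lev L k) M) ν ⊗ₖ (1 : Matrix o o ℂ))ᴴ
              * siteMul (fun i => ((lev L k : ℕ) : ℂ) • ((negConnM (fine (lev L k) M) ((lev L k : ℕ) : ℂ) (R k) ν (tau (fine (lev L k) M) ν i))ᴴ
                  - (negConnM (fine (lev L k) M) ((lev L k : ℕ) : ℂ) (R k) ν i)ᴴ))))
           + siteMul (zfieldC (fine (lev L k) M) ((lev L k : ℕ) : ℂ) (R k))) i j‖
      ≤ (d + 1) * (Real.exp δ' * ((Fintype.card o : ℝ) * β)) + (Fintype.card o : ℝ) * α' := by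
  have hw : ∀ i j : idx L M k × o,
      0 ≤ Real.exp (δ' * torusSupNorm M (rep M (blockOf (lev L k) M i.1.1) - rep M (blockOf (lev L k) M j.1.1))) :=
    fun _ _ => (Real.exp_pos _).le
  refine (wrow_add_le (fun i j : idx L M k × o => Real.exp (δ' * torusSupNorm M
      (rep M (blockOf (lev L k) M i.1.1) - rep M (blockOf (lev L k) M j.1.1)))) hw _ _ i).trans
    (add_le_add ?_ (wrow_siteMul_le L M k _ hzb δ' i))
  refine (wrow_sum_le Finset.univ (fun i j : idx L M k × o => Real.exp (δ' * torusSupNorm M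
      (rep M (blockOf (lev L k) M i.1.1) - rep M (blockOf (lev L k) M j.1.1)))) hw _ i).trans ?_
  calc ∑ ν : Fin (d + 1), ∑ j, Real.exp (δ' * torusSupNorm M (rep M (blockOf (lev L k) M i.1.1) - rep M (blockOf (lev L k) M j.1.1)))
          * ‖(-((shiftM (fine (lev L k) M) ν ⊗ₖ (1 : Matrix o o ℂ))ᴴ
              * siteMul (fun i => ((lev L k : ℕ) : ℂ) • ((negConnM (fine (lev L k) M) ((lev L k : ℕ) : ℂ) (R k) ν (tau (fine (lev L k) M) ν i))ᴴ
                  - (negConnM (fine (lev L k) M) ((lev L k : ℕ) : ℂ) (R k) ν i)ᴴ)))) i j‖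
      ≤ ∑ _ν : Fin (d + 1), Real.exp δ' * ((Fintype.card o : ℝ) * β) := by
        refine Finset.sum_le_sum fun ν _ => ?_
        simp only [Matrix.neg_apply, norm_neg]
        exact wrow_shiftKH_mul_siteMul_le L M k ν _ (norm_lipschitz_quot_le L M k hVl ν) hδ i
    _ = (d + 1) * (Real.exp δ' * ((Fintype.card o : ℝ) * β)) := by
        rw [Finset.sum_const, Finset.card_univ, Fintype.card_fin, nsmul_eq_mul]; push_cast; ring

end Regroup

/-! ## §4 `hdec` and the decay stations for tier A's colour model -/

section Stations

variable (L : ℕ) [NeZero L] (M : Fin (d + 1) → ℕ) [hM : ∀ μ, NeZero (M μ)]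
variable {o : Type*} [Fintype o] [DecidableEq o]

/-- **`hdec` FOR THE COVARIANT-LAPLACIAN PERTURBATION `covPertC L M R` AT SMALL COUPLING** on King's tower over a CUBIC unit torus `M ≡ N₀`
(`a = 1`, dimension `d + 1`), from RAW ENTRYWISE data only — size `α` of the entries of `−w`, `β/n_k`-Lipschitz entries, size `α′` of the entries of
`z` (NO two-level consistency, NO NE3 input; tier A's `LipschitzBackground`∕`BoundedBackground` and tier B's `RegularTransporters` both supply
them): for `0 ≤ δ′ < min(δ_∇, δ₁, δ₂)` and `‖t‖·κ_w < 1`,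
`κ_w = (d+1)·(card o·α·(1 + e^{δ′}))·B_∇K_{d+1}(δ_∇ − δ′) + ((d+1)·e^{δ′}·card o·β + card o·α′)·W_G(δ′)`:
`∀ k, EntryDecay dist₀ (pertCovC L M 1 _ (covPertC L M R) t k) (W_G(δ′)/(1 − ‖t‖κ_w)) δ′` — `SmallCouplingEntryDecayGrad.hdec_pertCovC_firstOrder` on
§3's regrouping.  MODEL level; Δ3 NOT closed for Bałaban's carrier; NE2 NOT proved. [folklore] -/
theorem hdec_pertCovC_covPertC {Bg δg : ℝ}
    (hgrad : ∀ (n N₀ : ℕ) [NeZero n] [NeZero N₀] (δ' : ℝ), δ' < δg →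
      ∀ (ν : Fin (d + 1)) (i : Tor (fine n (fun _ : Fin (d + 1) => N₀)) × Fin (d + 1)),
        ∑ x' : Tor (fine n (fun _ : Fin (d + 1) => N₀)) × Fin (d + 1),
            Real.exp (δ' * torusSupNorm (fun _ : Fin (d + 1) => N₀)
                (rep (fun _ : Fin (d + 1) => N₀) (blockOf n (fun _ : Fin (d + 1) => N₀) i.1)
                  - rep (fun _ : Fin (d + 1) => N₀) (blockOf n (fun _ : Fin (d + 1) => N₀) x'.1)))
              * ‖(fdiff (fine n (fun _ : Fin (d + 1) => N₀)) (n : ℂ) ν * (DeltaA n (fun _ : Fin (d + 1) => N₀) 1)⁻¹) i x'‖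
          ≤ Bg * latticeConst (d + 1) (δg - δ'))
    (N₀ : ℕ) [NeZero N₀] (hMc : M = fun _ => N₀) {δ' : ℝ} (hδ0 : 0 ≤ δ') (hδg : δ' < δg)
    (h₁ : δ' < 1 / (2 * ((d : ℝ) + 1))) (h₂ : δ' < kappa183 (d + 1) / (d + 1))
    {R : (k : ℕ) → Fin (d + 1) → (idx L M k → Matrix o o ℂ)} {α β α' : ℝ}
    (hVb : ∀ k ν (i : idx L M k) (a b : o), ‖negConnM (fine (lev L k) M) ((lev L k : ℕ) : ℂ) (R k) ν i a b‖ ≤ α)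
    (hVl : ∀ k ν (i : idx L M k) (a b : o), ‖negConnM (fine (lev L k) M) ((lev L k : ℕ) : ℂ) (R k) ν (tau (fine (lev L k) M) ν i) a b - negConnM (fine (lev L k) M) ((lev L k : ℕ) : ℂ) (R k) ν i a b‖ ≤ β / (lev L k : ℕ))
    (hzb : ∀ k (i : idx L M k) (a b : o), ‖zfieldC (fine (lev L k) M) ((lev L k : ℕ) : ℂ) (R k) i a b‖ ≤ α')
    {t : ℂ} (ht : ‖t‖ * ((d + 1) * (((Fintype.card o : ℝ) * α + Real.exp δ' * ((Fintype.card o : ℝ) * α)) * (Bg * latticeConst (d + 1) (δg - δ')))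
        + ((d + 1) * (Real.exp δ' * ((Fintype.card o : ℝ) * β)) + (Fintype.card o : ℝ) * α') * (2 * d * 2 ^ d * Real.exp (1 / (2 * (d + 1))) * latticeConst (d + 1) (1 / (2 * (d + 1)) - δ')
            + (d + 1) * (MD183 (d + 1) d * periodConst (kappa183 (d + 1)) d * latticeConst (d + 1) (kappa183 (d + 1) / (d + 1) - δ')))) < 1) (k : ℕ) :
    EntryDecay (fun x y : idx L M 0 × o => torusSupNorm M (fun ν => (((x.1.1 ν).val : ℕ) : ℤ) - (((y.1.1 ν).val : ℕ) : ℤ)))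
      (pertCovC L M 1 one_pos (covPertC L M R) t k) ((2 * d * 2 ^ d * Real.exp (1 / (2 * (d + 1))) * latticeConst (d + 1) (1 / (2 * (d + 1)) - δ')
            + (d + 1) * (MD183 (d + 1) d * periodConst (kappa183 (d + 1)) d * latticeConst (d + 1) (kappa183 (d + 1) / (d + 1) - δ'))) / (1 - ‖t‖ * ((d + 1) * (((Fintype.card o : ℝ) * α + Real.exp δ' * ((Fintype.card o : ℝ) * α)) * (Bg * latticeConst (d + 1) (δg - δ')))
        + ((d + 1) * (Real.exp δ' * ((Fintype.card o : ℝ) * β)) + (Fintype.card o : ℝ) * α') * (2 * d * 2 ^ d * Real.exp (1 / (2 * (d + 1))) * latticeConst (d + 1) (1 / (2 * (d + 1)) - δ')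
            + (d + 1) * (MD183 (d + 1) d * periodConst (kappa183 (d + 1)) d * latticeConst (d + 1) (kappa183 (d + 1) / (d + 1) - δ')))))) δ' := by
  have hP : covPertC L M R = fun k => (∑ ν, (siteMul (negConnM (fine (lev L k) M) ((lev L k : ℕ) : ℂ) (R k) ν)
            - (shiftM (fine (lev L k) M) ν ⊗ₖ (1 : Matrix o o ℂ))ᴴ
              * siteMul (fun i => (negConnM (fine (lev L k) M) ((lev L k : ℕ) : ℂ) (R k) ν (tau (fine (lev L k) M) ν i))ᴴ))
          * (fdiff (fine (lev L k) M) ((lev L k : ℕ) : ℂ) ν ⊗ₖ (1 : Matrix o o ℂ)))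
        + ((∑ ν, -((shiftM (fine (lev L k) M) ν ⊗ₖ (1 : Matrix o o ℂ))ᴴ
              * siteMul (fun i => ((lev L k : ℕ) : ℂ) • ((negConnM (fine (lev L k) M) ((lev L k : ℕ) : ℂ) (R k) ν (tau (fine (lev L k) M) ν i))ᴴ
                  - (negConnM (fine (lev L k) M) ((lev L k : ℕ) : ℂ) (R k) ν i)ᴴ))))
           + siteMul (zfieldC (fine (lev L k) M) ((lev L k : ℕ) : ℂ) (R k))) :=
    funext fun k => covPertC_eq_leftClass L M R k
  rw [hP]
  exact hdec_pertCovC_firstOrder L M hgrad N₀ hMc hδ0 hδg h₁ h₂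
    (C := fun ν k => siteMul (negConnM (fine (lev L k) M) ((lev L k : ℕ) : ℂ) (R k) ν)
            - (shiftM (fine (lev L k) M) ν ⊗ₖ (1 : Matrix o o ℂ))ᴴ
              * siteMul (fun i => (negConnM (fine (lev L k) M) ((lev L k : ℕ) : ℂ) (R k) ν (tau (fine (lev L k) M) ν i))ᴴ))
    (C₀ := fun k => (∑ ν, -((shiftM (fine (lev L k) M) ν ⊗ₖ (1 : Matrix o o ℂ))ᴴ
              * siteMul (fun i => ((lev L k : ℕ) : ℂ) • ((negConnM (fine (lev L k) M) ((lev L k : ℕ) : ℂ) (R k) ν (tau (fine (lev L k) M) ν i))ᴴ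
                  - (negConnM (fine (lev L k) M) ((lev L k : ℕ) : ℂ) (R k) ν i)ᴴ))))
           + siteMul (zfieldC (fine (lev L k) M) ((lev L k : ℕ) : ℂ) (R k)))
    (fun ν k i => wrow_Cfirst_le L M k (hVb k) hδ0 ν i) (fun k i => wrow_Czero_le L M k (hVl k) (hzb k) hδ0 i) ht k

/-- **`hdec` FOR TIER A's NON-ABELIAN COVARIANT-LAPLACIAN MODEL** in tier A's own letters — ENTRYWISE `LipschitzBackground` of `−w`
(`α, β`) and `BoundedBackground` of `z` (`α′, β′`): `hdec_pertCovC_covPertC` fed with their `bound`∕`lipschitz` fields (the `consistent`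
fields are NOT used).  MODEL level; Δ3 NOT closed; NE2 NOT proved. [folklore] -/
theorem hdec_pertCovC_colourCovariantLaplacian {Bg δg : ℝ}
    (hgrad : ∀ (n N₀ : ℕ) [NeZero n] [NeZero N₀] (δ' : ℝ), δ' < δg →
      ∀ (ν : Fin (d + 1)) (i : Tor (fine n (fun _ : Fin (d + 1) => N₀)) × Fin (d + 1)),
        ∑ x' : Tor (fine n (fun _ : Fin (d + 1) => N₀)) × Fin (d + 1),
            Real.exp (δ' * torusSupNorm (fun _ : Fin (d + 1) => N₀)
                (rep (fun _ : Fin (d + 1) => N₀) (blockOf n (fun _ : Fin (d + 1) => N₀) i.1)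
                  - rep (fun _ : Fin (d + 1) => N₀) (blockOf n (fun _ : Fin (d + 1) => N₀) x'.1)))
              * ‖(fdiff (fine n (fun _ : Fin (d + 1) => N₀)) (n : ℂ) ν * (DeltaA n (fun _ : Fin (d + 1) => N₀) 1)⁻¹) i x'‖
          ≤ Bg * latticeConst (d + 1) (δg - δ'))
    (N₀ : ℕ) [NeZero N₀] (hMc : M = fun _ => N₀) {δ' : ℝ} (hδ0 : 0 ≤ δ') (hδg : δ' < δg)
    (h₁ : δ' < 1 / (2 * ((d : ℝ) + 1))) (h₂ : δ' < kappa183 (d + 1) / (d + 1))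
    {R : (k : ℕ) → Fin (d + 1) → (idx L M k → Matrix o o ℂ)} {α β α' β' : ℝ}
    (hV : ∀ p : o × o, LipschitzBackground L M (Vab L M R p) α β) (hz : ∀ p : o × o, BoundedBackground L M (Zab L M R p) α' β')
    {t : ℂ} (ht : ‖t‖ * ((d + 1) * (((Fintype.card o : ℝ) * α + Real.exp δ' * ((Fintype.card o : ℝ) * α)) * (Bg * latticeConst (d + 1) (δg - δ')))
        + ((d + 1) * (Real.exp δ' * ((Fintype.card o : ℝ) * β)) + (Fintype.card o : ℝ) * α') * (2 * d * 2 ^ d * Real.exp (1 / (2 * (d + 1))) * latticeConst (d + 1) (1 / (2 * (d + 1)) - δ')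
            + (d + 1) * (MD183 (d + 1) d * periodConst (kappa183 (d + 1)) d * latticeConst (d + 1) (kappa183 (d + 1) / (d + 1) - δ')))) < 1) (k : ℕ) :
    EntryDecay (fun x y : idx L M 0 × o => torusSupNorm M (fun ν => (((x.1.1 ν).val : ℕ) : ℤ) - (((y.1.1 ν).val : ℕ) : ℤ)))
      (pertCovC L M 1 one_pos (covPertC L M R) t k) ((2 * d * 2 ^ d * Real.exp (1 / (2 * (d + 1))) * latticeConst (d + 1) (1 / (2 * (d + 1)) - δ')
            + (d + 1) * (MD183 (d + 1) d * periodConst (kappa183 (d + 1)) d * latticeConst (d + 1) (kappa183 (d + 1) / (d + 1) - δ'))) / (1 - ‖t‖ * ((d + 1) * (((Fintype.card o : ℝ) * α + Real.exp δ' * ((Fintype.card o : ℝ) * α)) * (Bg * latticeConst (d + 1) (δg - δ')))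
        + ((d + 1) * (Real.exp δ' * ((Fintype.card o : ℝ) * β)) + (Fintype.card o : ℝ) * α') * (2 * d * 2 ^ d * Real.exp (1 / (2 * (d + 1))) * latticeConst (d + 1) (1 / (2 * (d + 1)) - δ')
            + (d + 1) * (MD183 (d + 1) d * periodConst (kappa183 (d + 1)) d * latticeConst (d + 1) (kappa183 (d + 1) / (d + 1) - δ')))))) δ' :=
  hdec_pertCovC_covPertC L M hgrad N₀ hMc hδ0 hδg h₁ h₂ (fun k ν i a b => (hV (a, b)).bound k ν i)
    (fun k ν i a b => (hV (a, b)).lipschitz k ν ν i) (fun k i a b => (hz (a, b)).bound k i) ht k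

/-- **`hdec` FOR THE COVARIANT-LAPLACIAN SUMMAND OF TIER B's `balabanPert` IN TIER B's LETTERS** — from the row owner's regularity
class `RegularTransporters L M R α β` ALONE (`‖n_k(R − 1)‖ ≤ α`, lattice-Lipschitz `β/n_k`; `Support/RegularBackgroundTower`): entries ≤
matrix norms (`KroneckerUnits.norm_entry_le`), `norm_connTower_le`, `connTower_lipschitz`, `norm_zTower_le` (`‖z‖ ≤ (d+1)(α² + 2β)`) feed
`hdec_pertCovC_covPertC`; NO NE3 input, NO two-level consistency.  This is the `covPertC` third of `balabanPert = covPertC + avgPert + P₄`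
(`NE2BalabanLayer.tierBPert`); the other two summands are NOT treated here.  MODEL level; a = 1; cubic torus; NE2 NOT proved. [folklore] -/
theorem hdec_pertCovC_covPertC_of_regular {Bg δg : ℝ}
    (hgrad : ∀ (n N₀ : ℕ) [NeZero n] [NeZero N₀] (δ' : ℝ), δ' < δg →
      ∀ (ν : Fin (d + 1)) (i : Tor (fine n (fun _ : Fin (d + 1) => N₀)) × Fin (d + 1)),
        ∑ x' : Tor (fine n (fun _ : Fin (d + 1) => N₀)) × Fin (d + 1),
            Real.exp (δ' * torusSupNorm (fun _ : Fin (d + 1) => N₀)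
                (rep (fun _ : Fin (d + 1) => N₀) (blockOf n (fun _ : Fin (d + 1) => N₀) i.1)
                  - rep (fun _ : Fin (d + 1) => N₀) (blockOf n (fun _ : Fin (d + 1) => N₀) x'.1)))
              * ‖(fdiff (fine n (fun _ : Fin (d + 1) => N₀)) (n : ℂ) ν * (DeltaA n (fun _ : Fin (d + 1) => N₀) 1)⁻¹) i x'‖
          ≤ Bg * latticeConst (d + 1) (δg - δ'))
    (N₀ : ℕ) [NeZero N₀] (hMc : M = fun _ => N₀) {δ' : ℝ} (hδ0 : 0 ≤ δ') (hδg : δ' < δg)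
    (h₁ : δ' < 1 / (2 * ((d : ℝ) + 1))) (h₂ : δ' < kappa183 (d + 1) / (d + 1))
    {R : (k : ℕ) → Fin (d + 1) → (idx L M k → Matrix o o ℂ)} {α β : ℝ} (hreg : RegularTransporters L M R α β)
    {t : ℂ} (ht : ‖t‖ * ((d + 1) * (((Fintype.card o : ℝ) * α + Real.exp δ' * ((Fintype.card o : ℝ) * α)) * (Bg * latticeConst (d + 1) (δg - δ')))
        + ((d + 1) * (Real.exp δ' * ((Fintype.card o : ℝ) * β)) + (Fintype.card o : ℝ) * (((d + 1 : ℕ) : ℝ) * (α ^ 2 + 2 * β))) * (2 * d * 2 ^ d * Real.exp (1 / (2 * (d + 1))) * latticeConst (d + 1) (1 / (2 * (d + 1)) - δ')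
            + (d + 1) * (MD183 (d + 1) d * periodConst (kappa183 (d + 1)) d * latticeConst (d + 1) (kappa183 (d + 1) / (d + 1) - δ')))) < 1) (k : ℕ) :
    EntryDecay (fun x y : idx L M 0 × o => torusSupNorm M (fun ν => (((x.1.1 ν).val : ℕ) : ℤ) - (((y.1.1 ν).val : ℕ) : ℤ)))
      (pertCovC L M 1 one_pos (covPertC L M R) t k) ((2 * d * 2 ^ d * Real.exp (1 / (2 * (d + 1))) * latticeConst (d + 1) (1 / (2 * (d + 1)) - δ')
            + (d + 1) * (MD183 (d + 1) d * periodConst (kappa183 (d + 1)) d * latticeConst (d + 1) (kappa183 (d + 1) / (d + 1) - δ'))) / (1 - ‖t‖ * ((d + 1) * (((Fintype.card o : ℝ) * α + Real.exp δ' * ((Fintype.card o : ℝ) * α)) * (Bg * latticeConst (d + 1) (δg - δ')))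
        + ((d + 1) * (Real.exp δ' * ((Fintype.card o : ℝ) * β)) + (Fintype.card o : ℝ) * (((d + 1 : ℕ) : ℝ) * (α ^ 2 + 2 * β))) * (2 * d * 2 ^ d * Real.exp (1 / (2 * (d + 1))) * latticeConst (d + 1) (1 / (2 * (d + 1)) - δ')
            + (d + 1) * (MD183 (d + 1) d * periodConst (kappa183 (d + 1)) d * latticeConst (d + 1) (kappa183 (d + 1) / (d + 1) - δ')))))) δ' :=
  hdec_pertCovC_covPertC L M hgrad N₀ hMc hδ0 hδg h₁ h₂
    (fun k ν i a b => by
      rw [negConnM_eq_neg, Matrix.neg_apply, norm_neg]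
      exact (norm_entry_le _ a b).trans (norm_connTower_le hreg k ν i))
    (fun k ν i a b => by
      rw [negConnM_eq_neg, negConnM_eq_neg, Matrix.neg_apply, Matrix.neg_apply, neg_sub_neg, ← Matrix.sub_apply, ← neg_sub,
        Matrix.neg_apply, norm_neg]
      exact (norm_entry_le _ a b).trans (connTower_lipschitz hreg k ν ν i))
    (fun k i a b => (norm_entry_le _ a b).trans (norm_zTower_le hreg k i)) ht k

/-- **THE DECAY STATIONS FOR TIER A's COLOUR MODEL** (`L ≥ 2`, `a = 1`, cubic unit torus): the row owner's
`NE2BalabanDecayRate.decayStations_pertCovC` BY NAME with `hpert := perturbationLaws_colourCovariantLaplacian` and `hdec :=` the above —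
limit entry decay of `pertLimC`, King's (4.38) limit rate `DecayRate … (δ′/2) √(L⁻¹)` and two-level rate; displayed binders: the background
DATA bounds (`hV`, `hz`), `2 ≤ L`, the cubic torus, the rate window, the two coupling discs `‖t‖·κ_col < 1`, `‖t‖·κ_w < 1` — NOTHING ELSE
(no `hdec`, no NE3, no regularity class).  MODEL level (tier A); NE2 NOT proved. [cite: King1986, Lemma 4.5 (4.38) p.674 (shape)] [folklore] -/
theorem decayStations_colourCovariantLaplacian (hL : 2 ≤ L) {Bg δg : ℝ}
    (hgrad : ∀ (n N₀ : ℕ) [NeZero n] [NeZero N₀] (δ' : ℝ), δ' < δg →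
      ∀ (ν : Fin (d + 1)) (i : Tor (fine n (fun _ : Fin (d + 1) => N₀)) × Fin (d + 1)),
        ∑ x' : Tor (fine n (fun _ : Fin (d + 1) => N₀)) × Fin (d + 1),
            Real.exp (δ' * torusSupNorm (fun _ : Fin (d + 1) => N₀)
                (rep (fun _ : Fin (d + 1) => N₀) (blockOf n (fun _ : Fin (d + 1) => N₀) i.1)
                  - rep (fun _ : Fin (d + 1) => N₀) (blockOf n (fun _ : Fin (d + 1) => N₀) x'.1)))
              * ‖(fdiff (fine n (fun _ : Fin (d + 1) => N₀)) (n : ℂ) ν * (DeltaA n (fun _ : Fin (d + 1) => N₀) 1)⁻¹) i x'‖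
          ≤ Bg * latticeConst (d + 1) (δg - δ'))
    (N₀ : ℕ) [NeZero N₀] (hMc : M = fun _ => N₀) {δ' : ℝ} (hδ0 : 0 ≤ δ') (hδg : δ' < δg)
    (h₁ : δ' < 1 / (2 * ((d : ℝ) + 1))) (h₂ : δ' < kappa183 (d + 1) / (d + 1))
    {R : (k : ℕ) → Fin (d + 1) → (idx L M k → Matrix o o ℂ)} {α β α' β' : ℝ}
    (hV : ∀ p : o × o, LipschitzBackground L M (Vab L M R p) α β) (hz : ∀ p : o × o, BoundedBackground L M (Zab L M R p) α' β')
    {t : ℂ} (htκ : ‖t‖ * kappaCol o (d + 1) 1 α β α' < 1) (ht : ‖t‖ * ((d + 1) * (((Fintype.card o : ℝ) * α + Real.exp δ' * ((Fintype.card o : ℝ) * α)) * (Bg * latticeConst (d + 1) (δg - δ')))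
        + ((d + 1) * (Real.exp δ' * ((Fintype.card o : ℝ) * β)) + (Fintype.card o : ℝ) * α') * (2 * d * 2 ^ d * Real.exp (1 / (2 * (d + 1))) * latticeConst (d + 1) (1 / (2 * (d + 1)) - δ')
            + (d + 1) * (MD183 (d + 1) d * periodConst (kappa183 (d + 1)) d * latticeConst (d + 1) (kappa183 (d + 1) / (d + 1) - δ')))) < 1) :
    EntryDecay (fun x y : idx L M 0 × o => torusSupNorm M (fun ν => (((x.1.1 ν).val : ℕ) : ℤ) - (((y.1.1 ν).val : ℕ) : ℤ)))
        (pertLimC L M 1 one_pos (covPertC L M R) t) ((2 * d * 2 ^ d * Real.exp (1 / (2 * (d + 1))) * latticeConst (d + 1) (1 / (2 * (d + 1)) - δ')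
            + (d + 1) * (MD183 (d + 1) d * periodConst (kappa183 (d + 1)) d * latticeConst (d + 1) (kappa183 (d + 1) / (d + 1) - δ'))) / (1 - ‖t‖ * ((d + 1) * (((Fintype.card o : ℝ) * α + Real.exp δ' * ((Fintype.card o : ℝ) * α)) * (Bg * latticeConst (d + 1) (δg - δ')))
        + ((d + 1) * (Real.exp δ' * ((Fintype.card o : ℝ) * β)) + (Fintype.card o : ℝ) * α') * (2 * d * 2 ^ d * Real.exp (1 / (2 * (d + 1))) * latticeConst (d + 1) (1 / (2 * (d + 1)) - δ')
            + (d + 1) * (MD183 (d + 1) d * periodConst (kappa183 (d + 1)) d * latticeConst (d + 1) (kappa183 (d + 1) / (d + 1) - δ')))))) δ' ∧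
      DecayRate (fun x y : idx L M 0 × o => torusSupNorm M (fun ν => (((x.1.1 ν).val : ℕ) : ℤ) - (((y.1.1 ν).val : ℕ) : ℤ)))
        (pertCovC L M 1 one_pos (covPertC L M R) t) (pertLimC L M 1 one_pos (covPertC L M R) t)
        (Real.sqrt (2 * ((2 * d * 2 ^ d * Real.exp (1 / (2 * (d + 1))) * latticeConst (d + 1) (1 / (2 * (d + 1)) - δ')
            + (d + 1) * (MD183 (d + 1) d * periodConst (kappa183 (d + 1)) d * latticeConst (d + 1) (kappa183 (d + 1) / (d + 1) - δ'))) / (1 - ‖t‖ * ((d + 1) * (((Fintype.card o : ℝ) * α + Real.exp δ' * ((Fintype.card o : ℝ) * α)) * (Bg * latticeConst (d + 1) (δg - δ')))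
        + ((d + 1) * (Real.exp δ' * ((Fintype.card o : ℝ) * β)) + (Fintype.card o : ℝ) * α') * (2 * d * 2 ^ d * Real.exp (1 / (2 * (d + 1))) * latticeConst (d + 1) (1 / (2 * (d + 1)) - δ')
            + (d + 1) * (MD183 (d + 1) d * periodConst (kappa183 (d + 1)) d * latticeConst (d + 1) (kappa183 (d + 1) / (d + 1) - δ'))))))
          * (Cpert (kappaCol o (d + 1) 1 α β α') (2 * ((d + 1 : ℕ) : ℝ) * Cst (d + 1) 1) (CJ (d + 1) 1) (C2col o (d + 1) L 1 α β β') 0 t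
              / (1 - (L : ℝ)⁻¹)))) (δ' / 2) (Real.sqrt ((L : ℝ)⁻¹)) ∧
      TwoLevelDecayRate (fun x y : idx L M 0 × o => torusSupNorm M (fun ν => (((x.1.1 ν).val : ℕ) : ℤ) - (((y.1.1 ν).val : ℕ) : ℤ)))
        (pertCovC L M 1 one_pos (covPertC L M R) t)
        (Real.sqrt (2 * ((2 * d * 2 ^ d * Real.exp (1 / (2 * (d + 1))) * latticeConst (d + 1) (1 / (2 * (d + 1)) - δ')
            + (d + 1) * (MD183 (d + 1) d * periodConst (kappa183 (d + 1)) d * latticeConst (d + 1) (kappa183 (d + 1) / (d + 1) - δ'))) / (1 - ‖t‖ * ((d + 1) * (((Fintype.card o : ℝ) * α + Real.exp δ' * ((Fintype.card o : ℝ) * α)) * (Bg * latticeConst (d + 1) (δg - δ')))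
        + ((d + 1) * (Real.exp δ' * ((Fintype.card o : ℝ) * β)) + (Fintype.card o : ℝ) * α') * (2 * d * 2 ^ d * Real.exp (1 / (2 * (d + 1))) * latticeConst (d + 1) (1 / (2 * (d + 1)) - δ')
            + (d + 1) * (MD183 (d + 1) d * periodConst (kappa183 (d + 1)) d * latticeConst (d + 1) (kappa183 (d + 1) / (d + 1) - δ'))))))
          * (2 * Cpert (kappaCol o (d + 1) 1 α β α') (2 * ((d + 1 : ℕ) : ℝ) * Cst (d + 1) 1) (CJ (d + 1) 1) (C2col o (d + 1) L 1 α β β') 0 t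
              / (1 - (L : ℝ)⁻¹)))) (δ' / 2) (Real.sqrt ((L : ℝ)⁻¹)) :=
  decayStations_pertCovC L M 1 one_pos hL (perturbationLaws_colourCovariantLaplacian L M 1 one_pos (Nat.succ_pos d) hV hz) htκ
    (hdec_pertCovC_colourCovariantLaplacian L M hgrad N₀ hMc hδ0 hδg h₁ h₂ hV hz ht)

/-- **THE DECAY STATIONS FOR TIER A's COLOUR MODEL, PACKAGED**: there are `B_∇, δ_∇ > 0` depending on the dimension only (NE3's constants
through `GradientRowSumTransport.weighted_row_sum_fdiff_inv_le_cubic`) such that `decayStations_colourCovariantLaplacian` holds with them —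
the statement whose displayed binders are ONLY: `2 ≤ L`, the cubic torus `M ≡ N₀`, the rate window `0 ≤ δ′ < min(δ_∇, δ₁, δ₂)`, tier A's
background DATA bounds `hV`, `hz`, and the two coupling discs.  MODEL level (tier A); a = 1; Δ3 NOT closed for Bałaban's carrier;
NE2 NOT proved. [cite: King1986, Lemma 4.5 (4.38) p.674 (shape)] [folklore] -/
theorem decayStations_colourCovariantLaplacian_cubic (hL : 2 ≤ L) :
    ∃ Bg δg : ℝ, 0 < Bg ∧ 0 < δg ∧ ∀ (N₀ : ℕ) [NeZero N₀], M = (fun _ => N₀) →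
      ∀ (δ' : ℝ), 0 ≤ δ' → δ' < δg → δ' < 1 / (2 * ((d : ℝ) + 1)) → δ' < kappa183 (d + 1) / (d + 1) →
      ∀ (R : (k : ℕ) → Fin (d + 1) → (idx L M k → Matrix o o ℂ)) (α β α' β' : ℝ),
        (∀ p : o × o, LipschitzBackground L M (Vab L M R p) α β) → (∀ p : o × o, BoundedBackground L M (Zab L M R p) α' β') →
        ∀ (t : ℂ), ‖t‖ * kappaCol o (d + 1) 1 α β α' < 1 → ‖t‖ * ((d + 1) * (((Fintype.card o : ℝ) * α + Real.exp δ' * ((Fintype.card o : ℝ) * α)) * (Bg * latticeConst (d + 1) (δg - δ')))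
        + ((d + 1) * (Real.exp δ' * ((Fintype.card o : ℝ) * β)) + (Fintype.card o : ℝ) * α') * (2 * d * 2 ^ d * Real.exp (1 / (2 * (d + 1))) * latticeConst (d + 1) (1 / (2 * (d + 1)) - δ')
            + (d + 1) * (MD183 (d + 1) d * periodConst (kappa183 (d + 1)) d * latticeConst (d + 1) (kappa183 (d + 1) / (d + 1) - δ')))) < 1 →
    EntryDecay (fun x y : idx L M 0 × o => torusSupNorm M (fun ν => (((x.1.1 ν).val : ℕ) : ℤ) - (((y.1.1 ν).val : ℕ) : ℤ)))
        (pertLimC L M 1 one_pos (covPertC L M R) t) ((2 * d * 2 ^ d * Real.exp (1 / (2 * (d + 1))) * latticeConst (d + 1) (1 / (2 * (d + 1)) - δ')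
            + (d + 1) * (MD183 (d + 1) d * periodConst (kappa183 (d + 1)) d * latticeConst (d + 1) (kappa183 (d + 1) / (d + 1) - δ'))) / (1 - ‖t‖ * ((d + 1) * (((Fintype.card o : ℝ) * α + Real.exp δ' * ((Fintype.card o : ℝ) * α)) * (Bg * latticeConst (d + 1) (δg - δ')))
        + ((d + 1) * (Real.exp δ' * ((Fintype.card o : ℝ) * β)) + (Fintype.card o : ℝ) * α') * (2 * d * 2 ^ d * Real.exp (1 / (2 * (d + 1))) * latticeConst (d + 1) (1 / (2 * (d + 1)) - δ')
            + (d + 1) * (MD183 (d + 1) d * periodConst (kappa183 (d + 1)) d * latticeConst (d + 1) (kappa183 (d + 1) / (d + 1) - δ')))))) δ' ∧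
      DecayRate (fun x y : idx L M 0 × o => torusSupNorm M (fun ν => (((x.1.1 ν).val : ℕ) : ℤ) - (((y.1.1 ν).val : ℕ) : ℤ)))
        (pertCovC L M 1 one_pos (covPertC L M R) t) (pertLimC L M 1 one_pos (covPertC L M R) t)
        (Real.sqrt (2 * ((2 * d * 2 ^ d * Real.exp (1 / (2 * (d + 1))) * latticeConst (d + 1) (1 / (2 * (d + 1)) - δ')
            + (d + 1) * (MD183 (d + 1) d * periodConst (kappa183 (d + 1)) d * latticeConst (d + 1) (kappa183 (d + 1) / (d + 1) - δ'))) / (1 - ‖t‖ * ((d + 1) * (((Fintype.card o : ℝ) * α + Real.exp δ' * ((Fintype.card o : ℝ) * α)) * (Bg * latticeConst (d + 1) (δg - δ')))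
        + ((d + 1) * (Real.exp δ' * ((Fintype.card o : ℝ) * β)) + (Fintype.card o : ℝ) * α') * (2 * d * 2 ^ d * Real.exp (1 / (2 * (d + 1))) * latticeConst (d + 1) (1 / (2 * (d + 1)) - δ')
            + (d + 1) * (MD183 (d + 1) d * periodConst (kappa183 (d + 1)) d * latticeConst (d + 1) (kappa183 (d + 1) / (d + 1) - δ'))))))
          * (Cpert (kappaCol o (d + 1) 1 α β α') (2 * ((d + 1 : ℕ) : ℝ) * Cst (d + 1) 1) (CJ (d + 1) 1) (C2col o (d + 1) L 1 α β β') 0 t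
              / (1 - (L : ℝ)⁻¹)))) (δ' / 2) (Real.sqrt ((L : ℝ)⁻¹)) ∧
      TwoLevelDecayRate (fun x y : idx L M 0 × o => torusSupNorm M (fun ν => (((x.1.1 ν).val : ℕ) : ℤ) - (((y.1.1 ν).val : ℕ) : ℤ)))
        (pertCovC L M 1 one_pos (covPertC L M R) t)
        (Real.sqrt (2 * ((2 * d * 2 ^ d * Real.exp (1 / (2 * (d + 1))) * latticeConst (d + 1) (1 / (2 * (d + 1)) - δ')
            + (d + 1) * (MD183 (d + 1) d * periodConst (kappa183 (d + 1)) d * latticeConst (d + 1) (kappa183 (d + 1) / (d + 1) - δ'))) / (1 - ‖t‖ * ((d + 1) * (((Fintype.card o : ℝ) * α + Real.exp δ' * ((Fintype.card o : ℝ) * α)) * (Bg * latticeConst (d + 1) (δg - δ')))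
        + ((d + 1) * (Real.exp δ' * ((Fintype.card o : ℝ) * β)) + (Fintype.card o : ℝ) * α') * (2 * d * 2 ^ d * Real.exp (1 / (2 * (d + 1))) * latticeConst (d + 1) (1 / (2 * (d + 1)) - δ')
            + (d + 1) * (MD183 (d + 1) d * periodConst (kappa183 (d + 1)) d * latticeConst (d + 1) (kappa183 (d + 1) / (d + 1) - δ'))))))
          * (2 * Cpert (kappaCol o (d + 1) 1 α β α') (2 * ((d + 1 : ℕ) : ℝ) * Cst (d + 1) 1) (CJ (d + 1) 1) (C2col o (d + 1) L 1 α β β') 0 t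
              / (1 - (L : ℝ)⁻¹)))) (δ' / 2) (Real.sqrt ((L : ℝ)⁻¹)) := by
  obtain ⟨Bg, δg, hB, hδg, hgrad⟩ := weighted_row_sum_fdiff_inv_le_cubic (d := d)
  exact ⟨Bg, δg, hB, hδg, fun N₀ _ hMc δ' hδ0 hδ' h₁ h₂ R α β α' β' hV hz t htκ ht =>
    decayStations_colourCovariantLaplacian L M hL hgrad N₀ hMc hδ0 hδ' h₁ h₂ hV hz htκ ht⟩

end Stations

end Summit.QuantumFields.BalabanUV.T4Continuum.SmallCouplingEntryDecayCovariant

end
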